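import Summits.QuantumFields.BalabanUV.T4Continuum.Support.NE7StabiliserLiftingPrep
import Summits.QuantumFields.BalabanUV.T4Continuum.Support.NE7CriticalOrbitAnyDatum
import HarnessLib

/-!
# NE7StabiliserLifting — THE MINIMAL ORBIT NEVER BREAKS THE DATUM'S RESIDUAL SYMMETRY (`d = 4`, every `U(n)`, every `L ≥ 2`): over the small data, at every
# level, every coarse unitary periodic gauge transformation `s` FIXING THE DATUM `V₀` LIFTS to a fine unitary periodic gauge transformation `h` FIXING ANY
# GIVEN MINIMISER `U` over `V₀`, with corner values `h(L^k•z) = s(z)` — the corner map `Stab(U) → Stab(V₀)` is ONTO; hence the minimal orbit is ONE orbit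
# of the trivial-corner gauges, the Lagrange multiplier is constant on it, and the genericity hypothesis of `NE7MinimalActionDifferentiable.minAct_hasFDerivAt_generic`
# (ROAD-G114 §8's stabiliser design issue) is void at every small datum, level by level

Cell `pub-balaban`, rung (B)+1 sub-cell t4, lineage `b2b-balaban-t4-ne7b-p1` (row NE7b OWNER + CRUX PROVER; junction service for row NE7, ruling
R-OWNER-149-1 (2)), generation 158.  File 7 (assembly) of the junction census of ROAD-G114 §8's STABILISER DESIGN ISSUE (files 1–6: `NE7InvariantFunctionalLetter`,
`NE7SymmetricCriticality`, `NE7SymmetricAdmissibleWitness`, `NE7SymmetricFermat`, `NE7SymmetricFermatLevels`, `NE7StabiliserLiftingPrep`).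
THE ARGUMENT (Palais' symmetric criticality + [Balaban1985Variational] Thm 1's uniqueness clause).  `K := Stab(V₀)` (unitary `N`-periodic `s` with `V₀^s = V₀`),
lifted block-constantly to level `k`.  The iterated slab refinement of `V₀` is a `K̂`-fixed admissible configuration with the datum's plaquette radius `δ_V`
(`NE7SymmetricAdmissibleWitness`); the `K̂`-fixed admissible set is compact, so the level action has a `K̂`-fixed RESTRICTED minimiser `U_K`, whose action is at most
the slab's, whence (`NE7StabiliserLiftingPrep.smallField_of_levelAction_le`) its plaquette radius is `≤ √(card n·(N L^k)^4·6)·δ_V < ε∕(4L^{2k})` for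
`δ_V ≤ δ_V(ε, n, N, L, k)`: `U_K` is INTERIOR.  Restricted Fermat on the `K̂`-fixed subspace of NE3-R2's torus chart (`NE7SymmetricFermat(Levels)`) makes `U_K` critical along
the `K̂`-invariant tangent directions, Palais (`NE7SymmetricCriticality`) along all of them; gen 113's H10 `NE7CriticalOrbitAnyDatum.critical_is_minimiser_any_datum` then says
`U_K` is a minimiser and every minimiser `U` (critical by gen 113's Fermat) is `U_K^{u}` for a unitary periodic `u`, whose corner field `c` fixes `V₀`
(`cavgIter_gaugeAct`).  For `s ∈ Stab(V₀)`: `s′ := c s c⁻¹ ∈ Stab(V₀)`, `ŝ′` fixes `U_K`, and `h := u⁻¹ ŝ′ u` fixes `U` with corners `c⁻¹ s′ c = s`.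
WHAT ([folklore]; 0 def, 0 sorry; `d = 4`, every `U(n)`, every `L ≥ 2`, thresholds existential, the datum radius `δ_V` depending on `(ε, n, N, L, k)`).  §1 `gaugeAct_mul`,
`isPeriodicSite_corner`; §2 **`exists_fixed_minimiser`** (a minimiser fixed by the lifts of ALL of `Stab(V₀)`, and every minimiser is its gauge copy); §3
**`stabiliser_lifting`** (the LIFTING theorem).
HONEST LIMITS.  `δ_V` is chosen PER LEVEL `k` (the slab witness carries the datum's plaquette radius; a `k`-uniform `δ_V` needs a symmetric witness with plaquettes
`O(δ_V L^{−2k})` — a symmetric smooth interpolation or a symmetric continuity method —, not typed); the road's theorems quantify `∃ δ_V ∀ j`, so consuming this at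
level `j+1` means shrinking their `δ_V` with `j`.  OUR minimisers ∕ OUR route, nothing of Bałaban's asserted; NOT NE7 as a spine node, NOT NE3, row NE7b NOT PRINTED ∕
NOT PROVED; spine 0∕9; finite T⁴ rung (B)+1 — NOT infinite volume, NOT mass gap, NOT BetaPertH, NOT Clay (continuum YM on T⁴ ⇐ BetaPertH ∧ nine spine estimates).
-/

set_option autoImplicit false

open scoped BigOperators Matrix Matrix.Norms.L2Operator
open NormedSpace Finset Set

namespace Summit.QuantumFields.BalabanUV.T4Continuum.NE7StabiliserLifting

open Literature.MathematicalPhysics.QuantumFieldTheory.Balaban1983to89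
open B7Prop1Explicit B7Prop2Explicit MatrixNorms
open T4AveragingDeficitWall (IsUnitaryCfg IsSkewDir SmallField)
open T4AveragingDeficitWallBoundary (IsPeriodicCfg periodBox)
open AveragingDeficitPeriodicCounting (IsPeriodicDir)
open AveragingDeficitMultiLevelPrep (LevelSmall TangentIter cavgIter)
open AveragingDeficitMultiLevelBridge (cavgIter_eq_avgIter)
open MinimalActionLevels (perWin levelAction)
open MinimalActionSandwich (IsMinimiser admissible)
open MinimalActionRate (sfClass)
open NE3HessForm (dAction)
open NE3EnergyShapes (IsUnitarySite IsPeriodicSite)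
open NE3CpushGaugeCovariance (cavgIter_gaugeAct)
open AveragingDeficitKDatum (gaugeAct_inv_gaugeAct)
open NE7EnergyClassPoincareGeneric (classPackage)
open NE7CriticalOrbitUniqueGeneric (tanCritical_of_isMinimiser_smallData)
open NE7CriticalOrbitAnyDatum (critical_is_minimiser_any_datum)
open NE7SymmetricAdmissibleWitness (exists_symmetric_admissible exists_symmetric_restricted_minimiser)
open NE7StabiliserLiftingPrep (isUnitarySite_lift isPeriodicSite_lift smallField_of_levelAction_le tanCritical_of_symmetricRestrictedMinimiser)

noncomputable section

variable {n : Type} [Fintype n] [DecidableEq n]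

/-! ## §1 Two pieces of gauge bookkeeping -/

/-- `V^{wu} = (V^{u})^{w}`. [folklore] -/
theorem gaugeAct_mul {d : ℕ} (w u : Site d → (Matrix n n ℂ)ˣ) (V : Site d → Fin d → (Matrix n n ℂ)ˣ) :
    gaugeAct (fun x => w x * u x) V = gaugeAct w (gaugeAct u V) := by
  funext x μ
  simp only [gaugeAct, mul_inv_rev, mul_assoc]

/-- The corner field `z ↦ u(M•z)` of an `(N·M)`-periodic site field is `N`-periodic. [folklore] -/
theorem isPeriodicSite_corner {d : ℕ} {u : Site d → (Matrix n n ℂ)ˣ} {N M : ℕ} (huP : IsPeriodicSite u ((N * M : ℕ) : ℤ)) :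
    IsPeriodicSite (fun z : Site d => u ((M : ℤ) • z)) (N : ℤ) := by
  intro z i
  show u ((M : ℤ) • (z + (N : ℤ) • e i)) = u ((M : ℤ) • z)
  have h : (M : ℤ) • (z + (N : ℤ) • e i) = (M : ℤ) • z + ((N * M : ℕ) : ℤ) • e i := by
    rw [smul_add, smul_smul]; push_cast; rw [mul_comm]
  rw [h, huP]

/-! ## §2 A minimiser fixed by the lifts of the whole stabiliser of the datum -/

/-- **A MINIMISER FIXED BY THE LIFTED STABILISER OF THE DATUM, AND EVERY MINIMISER IS ITS GAUGE COPY** (`d = 4`, every `U(n)`, `L ≥ 2`): for `0 < ε ≤ ε₀(n, L)`, `N ≥ 1`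
and every level `k` there is `δ_V > 0` such that over every unitary `N`-periodic datum `V₀` with `SmallField V₀ δ_V` there is a minimiser `U_K` of `sfClass 4 L N ε` at
level `k` FIXED by `x ↦ s(⌊x∕L^k⌋)` for EVERY unitary `N`-periodic `s` with `V₀^s = V₀`, and every minimiser over `V₀` is `U_K^{u}⁻…` — precisely `gaugeAct u U = U_K` —
for some unitary `(N·L^k)`-periodic `u`. [folklore] -/
theorem exists_fixed_minimiser [Nonempty n] {L : ℕ} (hL : 2 ≤ L) :
    ∃ ε₀ : ℝ, 0 < ε₀ ∧ ∀ ε : ℝ, 0 < ε → ε ≤ ε₀ → ∀ (N : ℕ) [NeZero N], 1 ≤ N → ∀ k : ℕ, ∃ δV : ℝ, 0 < δV ∧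
      ∀ V₀ ∈ {V : Site 4 → Fin 4 → (Matrix n n ℂ)ˣ | IsUnitaryCfg V ∧ IsPeriodicCfg V (N : ℤ) ∧ SmallField V δV},
      ∃ UK : Site 4 → Fin 4 → (Matrix n n ℂ)ˣ, IsMinimiser 4 (sfClass 4 L N ε) L N k V₀ UK ∧
        (∀ s : Site 4 → (Matrix n n ℂ)ˣ, IsUnitarySite s → IsPeriodicSite s (N : ℤ) → gaugeAct s V₀ = V₀ →
          gaugeAct (fun x : Site 4 => s (fun i => x i / ((L : ℤ) ^ k))) UK = UK) ∧
        ∀ U : Site 4 → Fin 4 → (Matrix n n ℂ)ˣ, IsMinimiser 4 (sfClass 4 L N ε) L N k V₀ U →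
          ∃ u : Site 4 → (Matrix n n ℂ)ˣ, IsUnitarySite u ∧ IsPeriodicSite u ((N * L ^ k : ℕ) : ℤ) ∧ gaugeAct u U = UK := by
  classical
  haveI : NeZero L := ⟨by omega⟩
  have hL1 : 1 ≤ L := by omega
  have hL0 : (0 : ℝ) < L := by exact_mod_cast (show 0 < L by omega)
  obtain ⟨εH, hεH, H10⟩ := critical_is_minimiser_any_datum (n := n) hL
  obtain ⟨εT, hεT, HT⟩ := tanCritical_of_isMinimiser_smallData (n := n) hL
  obtain ⟨θ₀, CF, CE, hθ₀, -, -, -, hC0θ, hDθ, hlsP, -, -⟩ := classPackage (n := n) (d := 4) (by norm_num) hL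
  refine ⟨min εH (min εT θ₀), lt_min hεH (lt_min hεT hθ₀), fun ε hε hεle N _ hN k => ?_⟩
  have hεH' : ε ≤ εH := hεle.trans (min_le_left _ _)
  have hεT' : ε ≤ εT := hεle.trans ((min_le_right _ _).trans (min_le_left _ _))
  have hεθ : ε ≤ θ₀ := hεle.trans ((min_le_right _ _).trans (min_le_right _ _))
  have hls : ∀ j : ℕ, LevelSmall 4 L j (ε / ((L : ℝ) ^ (j + 1)) ^ 2) := hlsP hε.le hεθ
  -- the compactness regime at radius `ε`
  have hε1 : 16 * C0 4 * ε ≤ 3 := (mul_le_mul_of_nonneg_left hεθ (by have := C0_pos 4; positivity)).trans hC0θ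
  have hε2 : 1024 * ((4 : ℕ) + 1 : ℝ) * ((4 : ℕ) + 4 : ℝ) * (L : ℝ) ^ 2 * ε ≤ 1 :=
    (mul_le_mul_of_nonneg_left hεθ (by positivity)).trans hDθ
  obtain ⟨δT, hδT, hT⟩ := HT ε hε hεT' N hN
  -- the datum radius at level `k`
  set Λ : ℝ := Real.sqrt ((Fintype.card n : ℝ) * ((((N * L ^ k : ℕ) : ℝ)) ^ 4 * Fintype.card (T4AveragingDeficitWall.Plane 4))) with hΛ
  have hΛ0 : 0 ≤ Λ := Real.sqrt_nonneg _
  have hM0 : (0 : ℝ) < ((L : ℝ) ^ k) ^ 2 := by positivity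
  set δV : ℝ := min δT ((ε / 8) / (((L : ℝ) ^ k) ^ 2 * (Λ + 1))) with hδV
  have hδV0 : 0 < δV := lt_min hδT (by positivity)
  have hδVT : δV ≤ δT := min_le_left _ _
  have hδV2 : δV ≤ (ε / 8) / (((L : ℝ) ^ k) ^ 2 * (Λ + 1)) := min_le_right _ _
  have hδVε : δV ≤ ε / ((L : ℝ) ^ k) ^ 2 := by
    refine hδV2.trans ?_
    rw [div_le_div_iff₀ (by positivity) hM0]
    have h1 : 0 ≤ ε * ((L : ℝ) ^ k) ^ 2 * Λ := by positivity
    have h2 : 0 ≤ ε * ((L : ℝ) ^ k) ^ 2 := by positivity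
    nlinarith [h1, h2]
  have hΛδ : Λ * δV < (ε / 4) / ((L : ℝ) ^ k) ^ 2 := by
    have h1 : Λ * δV ≤ Λ * ((ε / 8) / (((L : ℝ) ^ k) ^ 2 * (Λ + 1))) := mul_le_mul_of_nonneg_left hδV2 hΛ0
    have h2 : Λ * ((ε / 8) / (((L : ℝ) ^ k) ^ 2 * (Λ + 1))) ≤ (ε / 8) / ((L : ℝ) ^ k) ^ 2 := by
      rw [mul_div_assoc', div_le_div_iff₀ (by positivity) hM0]
      have h1 : 0 ≤ ε * ((L : ℝ) ^ k) ^ 2 * Λ := by positivity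
      have h2 : 0 ≤ ε * ((L : ℝ) ^ k) ^ 2 := by positivity
      nlinarith [h1, h2]
    have h3 : (ε / 8) / ((L : ℝ) ^ k) ^ 2 < (ε / 4) / ((L : ℝ) ^ k) ^ 2 := div_lt_div_of_pos_right (by linarith) hM0
    linarith
  refine ⟨δV, hδV0, fun V₀ hV₀ => ?_⟩
  obtain ⟨hV₀u, hV₀P, hV₀δ⟩ := hV₀
  -- the stabiliser of the datum
  set K : Set (Site 4 → (Matrix n n ℂ)ˣ) := {s | IsUnitarySite s ∧ IsPeriodicSite s (N : ℤ) ∧ gaugeAct s V₀ = V₀} with hK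
  have hKu : ∀ s ∈ K, IsUnitarySite s := fun s hs => hs.1
  have hKP : ∀ s ∈ K, IsPeriodicSite s (N : ℤ) := fun s hs => hs.2.1
  have hKfix : ∀ s ∈ K, gaugeAct s V₀ = V₀ := fun s hs => hs.2.2
  -- the symmetric witness and the symmetric restricted minimiser
  obtain ⟨W, hWu, hWP, hWδ, hWavg, hWsym⟩ := exists_symmetric_admissible (n := n) hL1 k hV₀u hV₀P hδV0.le hV₀δ
  obtain ⟨UK, hUKadm, hUKfix, hUKmin⟩ :=
    exists_symmetric_restricted_minimiser (n := n) hL hε.le hε1 hε2 k hV₀u hV₀P hδV0.le hV₀δ hδVε K hKfix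
  have hWadm : W ∈ admissible (sfClass 4 L N ε) L k V₀ := ⟨⟨hWu, hWP, MinimalActionRate.SmallField.mono hWδ hδVε⟩, hWavg⟩
  have hle : levelAction 4 L N k UK ≤ levelAction 4 L N k W := hUKmin W hWadm fun s hs => hWsym s (hKfix s hs)
  -- interiority of the restricted minimiser
  haveI : NeZero (N * L ^ k) := ⟨Nat.mul_ne_zero (NeZero.ne N) (pow_ne_zero _ (NeZero.ne L))⟩
  obtain ⟨⟨hUKu, hUKP, hUKε⟩, hUKavg⟩ := id hUKadm
  have hUKa : SmallField UK (Λ * δV) := smallField_of_levelAction_le (d := 4) hL1 hUKu hUKP hWu hδV0.le hWδ hle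
  have haε : Λ * δV < ε / ((L : ℝ) ^ k) ^ 2 :=
    hΛδ.trans (div_lt_div_of_pos_right (by linarith) hM0)
  -- tangent-criticality of `UK` (levels `k = j+1`), in H10's form
  have hcrit : ∀ j : ℕ, k = j + 1 → ∀ φ : Site 4 → Fin 4 → Matrix n n ℂ, IsSkewDir φ → IsPeriodicDir φ ((N * L ^ (j + 1) : ℕ) : ℤ) →
      TangentIter L j UK φ → dAction UK φ (perWin 4 (N * L ^ (j + 1))) = 0 := by
    intro j hj φ hφs hφP hφT
    subst hj
    exact tanCritical_of_symmetricRestrictedMinimiser (d := 4) hL1 hε.le hUKadm K hKu hKP hUKfix hUKmin (mul_nonneg hΛ0 hδV0.le)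
      haε hUKa (hls j) φ hφs hφP hφT
  obtain ⟨hUKmin', horbit⟩ := H10 ε hε hεH' N hN V₀ k UK hUKadm hcrit
  refine ⟨UK, hUKmin', fun s hsu hsP hsfix => hUKfix s ⟨hsu, hsP, hsfix⟩, fun U hU => ?_⟩
  -- every minimiser is critical (gen 113's Fermat over the small data), hence a gauge copy of `UK`
  have hV₀T : V₀ ∈ {V : Site 4 → Fin 4 → (Matrix n n ℂ)ˣ | IsUnitaryCfg V ∧ IsPeriodicCfg V (N : ℤ) ∧ SmallField V δT} :=
    ⟨hV₀u, hV₀P, MinimalActionRate.SmallField.mono hV₀δ hδVT⟩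
  have hcritU : ∀ j : ℕ, k = j + 1 → ∀ φ : Site 4 → Fin 4 → Matrix n n ℂ, IsSkewDir φ → IsPeriodicDir φ ((N * L ^ (j + 1) : ℕ) : ℤ) →
      TangentIter L j U φ → dAction U φ (perWin 4 (N * L ^ (j + 1))) = 0 := by
    intro j hj φ hφs hφP hφT
    subst hj
    exact hT V₀ hV₀T j U hU φ hφs hφP hφT
  exact horbit U hU.mem hcritU

/-! ## §3 The lifting theorem -/

/-- **STABILISER LIFTING — THE MINIMAL ORBIT DOES NOT BREAK THE DATUM'S RESIDUAL SYMMETRY** (`d = 4`, every `U(n)`, every `L ≥ 2`): for `0 < ε ≤ ε₀(n, L)`, `N ≥ 1` and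
every level `k` there is `δ_V > 0` such that for every unitary `N`-periodic datum `V₀` with `SmallField V₀ δ_V`, every minimiser `U` of `sfClass 4 L N ε` at level `k` over
`V₀`, and every unitary `N`-periodic `s` with `V₀^s = V₀`, there is a unitary `(N·L^k)`-periodic `h` with `U^h = U` and corner values `h(L^k•z) = s(z)`.  Hence the corner
map `Stab(U) → Stab(V₀)` is onto, the minimal orbit over `V₀` is one orbit of the trivial-corner gauges, and the Lipschitz gauge copy of
`NE7MinimiserLipschitzChart.minimiser_lipschitz_chart` can always be taken over the same datum. [folklore] -/
theorem stabiliser_lifting [Nonempty n] {L : ℕ} (hL : 2 ≤ L) :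
    ∃ ε₀ : ℝ, 0 < ε₀ ∧ ∀ ε : ℝ, 0 < ε → ε ≤ ε₀ → ∀ (N : ℕ) [NeZero N], 1 ≤ N → ∀ k : ℕ, ∃ δV : ℝ, 0 < δV ∧
      ∀ V₀ ∈ {V : Site 4 → Fin 4 → (Matrix n n ℂ)ˣ | IsUnitaryCfg V ∧ IsPeriodicCfg V (N : ℤ) ∧ SmallField V δV},
      ∀ U : Site 4 → Fin 4 → (Matrix n n ℂ)ˣ, IsMinimiser 4 (sfClass 4 L N ε) L N k V₀ U →
      ∀ s : Site 4 → (Matrix n n ℂ)ˣ, IsUnitarySite s → IsPeriodicSite s (N : ℤ) → gaugeAct s V₀ = V₀ →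
        ∃ h : Site 4 → (Matrix n n ℂ)ˣ, IsUnitarySite h ∧ IsPeriodicSite h ((N * L ^ k : ℕ) : ℤ) ∧ gaugeAct h U = U ∧
          ∀ z : Site 4, h (((L : ℤ) ^ k) • z) = s z := by
  classical
  haveI : NeZero L := ⟨by omega⟩
  have hL1 : 1 ≤ L := by omega
  obtain ⟨ε₀, hε₀, H⟩ := exists_fixed_minimiser (n := n) hL
  obtain ⟨θ₀, CF, CE, hθ₀, -, -, -, -, -, hlsP, -, -⟩ := classPackage (n := n) (d := 4) (by norm_num) hL
  refine ⟨min ε₀ θ₀, lt_min hε₀ hθ₀, fun ε hε hεle N _ hN k => ?_⟩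
  have hεθ : ε ≤ θ₀ := hεle.trans (min_le_right _ _)
  have hls : ∀ j : ℕ, LevelSmall 4 L j (ε / ((L : ℝ) ^ (j + 1)) ^ 2) := hlsP hε.le hεθ
  obtain ⟨δV, hδV, H1⟩ := H ε hε (hεle.trans (min_le_left _ _)) N hN k
  refine ⟨δV, hδV, fun V₀ hV₀ U hU s hsu hsP hsfix => ?_⟩
  obtain ⟨hV₀u, hV₀P, hV₀δ⟩ := hV₀
  obtain ⟨UK, hUK, hUKfix, hcopy⟩ := H1 V₀ ⟨hV₀u, hV₀P, hV₀δ⟩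
  obtain ⟨u, hu, huP, hug⟩ := hcopy U hU
  have hLk : 1 ≤ L ^ k := Nat.one_le_pow _ _ hL1
  have hLk0 : ((L : ℤ) ^ k) ≠ 0 := pow_ne_zero _ (by exact_mod_cast (by omega : L ≠ 0))
  have hcast : (((L ^ k : ℕ) : ℤ)) = (L : ℤ) ^ k := by push_cast; ring
  -- the corner field of `u` fixes the datum
  set c : Site 4 → (Matrix n n ℂ)ˣ := fun z => u (((L : ℤ) ^ k) • z) with hc
  have hcu : IsUnitarySite c := fun z => hu _
  have hcP : IsPeriodicSite c (N : ℤ) := by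
    have huP' : IsPeriodicSite u ((N * L ^ k : ℕ) : ℤ) := huP
    have h := isPeriodicSite_corner (M := L ^ k) huP'
    simp only [hcast] at h
    exact h
  have hcfix : gaugeAct c V₀ = V₀ := by
    cases k with
    | zero =>
        -- level `0`: `U = V₀ = UK`, `c = u`
        have hU0 : U = V₀ := hU.mem.2
        have hUK0 : UK = V₀ := hUK.mem.2
        have hcu' : c = u := by funext z; simp only [hc, pow_zero, one_smul]
        rw [hcu']
        have h := hug
        rw [hU0, hUK0] at h
        exact h
    | succ j =>
        obtain ⟨⟨hUu, hUP, hUε⟩, hUavg⟩ := hU.mem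
        have hx : 0 ≤ ε / ((L : ℝ) ^ (j + 1)) ^ 2 := by positivity
        have h1 := cavgIter_gaugeAct (d := 4) hL1 j hUu hx (hls j) hUε (u := u) hu
        rw [hug, cavgIter_eq_avgIter, cavgIter_eq_avgIter, hUK.mem.2, hUavg] at h1
        exact h1.symm
  -- the conjugated stabiliser element and its lift
  set s' : Site 4 → (Matrix n n ℂ)ˣ := fun z => c z * s z * (c z)⁻¹ with hs'
  have hs'u : IsUnitarySite s' := fun z =>
    (unitaryUnits (Matrix n n ℂ)).mul_mem ((unitaryUnits (Matrix n n ℂ)).mul_mem (hcu z) (hsu z)) ((unitaryUnits (Matrix n n ℂ)).inv_mem (hcu z))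
  have hs'P : IsPeriodicSite s' (N : ℤ) := fun z i => by simp only [hs', hcP z i, hsP z i]
  have hcinv : gaugeAct (fun z => (c z)⁻¹) V₀ = V₀ := by
    conv_lhs => rw [← hcfix]
    exact gaugeAct_inv_gaugeAct c V₀
  have hs'fix : gaugeAct s' V₀ = V₀ := by
    have h1 : s' = fun z => (fun z => c z * s z) z * (fun z => (c z)⁻¹) z := rfl
    rw [h1, gaugeAct_mul, gaugeAct_mul, hcinv, hsfix, hcfix]
  have hlift : gaugeAct (fun x : Site 4 => s' (fun i => x i / ((L : ℤ) ^ k))) UK = UK := hUKfix s' hs'u hs'P hs'fix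
  -- the lift of `s`
  refine ⟨fun x => (u x)⁻¹ * ((fun x : Site 4 => s' (fun i => x i / ((L : ℤ) ^ k))) x * u x), fun x => ?_, fun x i => ?_, ?_, fun z => ?_⟩
  · exact (unitaryUnits (Matrix n n ℂ)).mul_mem ((unitaryUnits (Matrix n n ℂ)).inv_mem (hu x))
      ((unitaryUnits (Matrix n n ℂ)).mul_mem (hs'u _) (hu x))
  · have hp := isPeriodicSite_lift (d := 4) hs'P hLk x i
    simp only [hcast] at hp
    have hup := huP x i
    simp only [hp, hup]
  · rw [gaugeAct_mul, gaugeAct_mul, hug, hlift, ← hug, gaugeAct_inv_gaugeAct]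
  · have hdiv : (fun i => (((L : ℤ) ^ k) • z) i / ((L : ℤ) ^ k)) = z := by
      funext i
      simp only [Pi.smul_apply, smul_eq_mul]
      exact Int.mul_ediv_cancel_left _ hLk0
    show (u (((L : ℤ) ^ k) • z))⁻¹ * (s' (fun i => (((L : ℤ) ^ k) • z) i / ((L : ℤ) ^ k)) * u (((L : ℤ) ^ k) • z)) = s z
    rw [hdiv]
    show (c z)⁻¹ * (c z * s z * (c z)⁻¹ * c z) = s z
    group

end

end Summit.QuantumFields.BalabanUV.T4Continuum.NE7StabiliserLifting
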